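import Summits.AtomisticToContinuum.HydrodynamicLimit.Theorems.InformationPercolationEngineChaosClosesEulerPressureValueL
import Summits.AtomisticToContinuum.HydrodynamicLimit.Theorems.InformationPercolationEngineChaosClosesEulerStressIsotropyE
import HarnessLib

/-!
# Collisional pressure value in band (crux `ChaosClosesEuler`, stmt-AtomisticToContinuum-15141, line `Sketch`,
# stub `stub_pressureValueOfEnskog`) — helper M: the pathwise core

WHAT. `pathwise_core` — along ONE good orbit, the collisional pressure defect
`D = Σ_kl K_t[a_kl gc |⟪v⁻−w⁻,n̂⟫| n̂ₖn̂ₗ] − 2∫₀ᵗ∫ gc(σ³ρ_r) p_ex tr a`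
is bounded by an explicit combination of: the quadratic collision-mark functional (CMUI level `L²`), the nine
pointwise-Enskog-collision defects of the truncated stress marks and the one of the dominating mark, the energy
level `K`, the time-integrated cubic speed tail `κ`, the ten pointwise-local-equilibrium errors `η′` of the
stress-isotropy tests, the joint `r`-modulus `ω` of `a` and the scale `r` — by chaining the collision-side estimates
(helpers K, L), the Enskog-side estimates (helper J) and the landed stress-isotropy estimate
`ChaosClosesEulerStressIsotropy.pathwise_bound` for the traceless part of `a` with the in-band weight
`g̃(b) = gc(b) Ỹ(b) b`.

References: P. Résibois, M. De Leener (1977) Ch. VI §3; H. van Beijeren, M. H. Ernst, Physica 68 (1973).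
-/

noncomputable section

namespace Summit.AtomisticToContinuum.HydrodynamicLimit.Theorems.ChaosClosesEulerPressureValue

open scoped BigOperators Topology Classical MeasureTheory ENNReal InnerProductSpace
open Filter Set MeasureTheory
open Literature.MathematicalPhysics.KineticTheory
open Literature.Analysis.FluidPDE
open Summit.AtomisticToContinuum.HydrodynamicLimit.Theorems.LocalSecondLawNegative
open Summit.AtomisticToContinuum.HydrodynamicLimit.Theorems.LocalSecondLawLedger
open Summit.AtomisticToContinuum.HydrodynamicLimit.Theorems.LocalSecondLawLedger.L
  (Mmom rhoC_eq_sum momC_apply_eq_sum momC_eq_sum kinC_eq_trace norm_sq_eq_sum)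

/-- The truncated stress mark `𝒯[L,k,l]` (local notation for an explicit lambda). -/
local notation3 "𝒯[" L ", " k ", " l "]" => fun q : V3 × V3 × V3 =>
  min |⟪q.2.1 - q.2.2, q.1⟫_ℝ| (4 * L) * (speedCutoff L ‖q.2.1‖ * speedCutoff L ‖q.2.2‖) * (clip1 (q.1 k) * clip1 (q.1 l))

/-- The dominating mark `ℬ[L]` (local notation for an explicit lambda). -/
local notation3 "ℬ[" L "]" => fun q : V3 × V3 × V3 => 4 * L * (speedCutoff L ‖q.2.1‖ * speedCutoff L ‖q.2.2‖)

section Core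

open Function
open Summit.AtomisticToContinuum.HydrodynamicLimit.Theorems.ChaosClosesEulerStressIsotropy

variable {σ : ℝ} {N : ℕ} (Φ : HardSphereFlow (Torus.geometry (Fin 3)) (hsDiameter σ N) (N + 1)) {z : Phase N}

/-- The traceless part `ã = a − (tr a/3)𝟙` of a coefficient is traceless. [folklore] -/
theorem traceless_part (a : Fin 3 → Fin 3 → ℝ × T3 → ℝ) (p : ℝ × T3) :
    ∑ j : Fin 3, (a j j p - (∑ i : Fin 3, a i i p) / 3 * (if j = j then (1 : ℝ) else 0)) = 0 := by
  simp only [if_true, mul_one, Finset.sum_sub_distrib, Finset.sum_const, Finset.card_univ, Fintype.card_fin,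
    nsmul_eq_mul]
  push_cast; ring

/-- **The pathwise core.** See the module docstring. [folklore] -/
theorem pathwise_core
    (hMM : ∀ (ρ θ : ℝ) (u : V3), 0 < ρ → 0 < θ →
      let m : Measure V3 := volume.withDensity (fun v => ENNReal.ofReal (localMaxwellian ρ θ u v))
      IsFiniteMeasure m ∧ Integrable (fun v : V3 => ‖v‖ ^ 2) m ∧
      (m Set.univ).toReal = ρ ∧ (∀ j : Fin 3, ∫ v, v j ∂m = ρ * u j) ∧
      (∀ j k : Fin 3, ∫ v, v j * v k ∂m = ρ * (u j * u k + if j = k then θ else 0)) ∧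
      (∫ v, ‖v‖ ^ 2 ∂m = ρ * (‖u‖ ^ 2 + 3 * θ)) ∧
      (∀ ψ : V3 → ℝ, Continuous ψ → (∃ C : ℝ, ∀ v, |ψ v| ≤ C) →
        Integrable ψ m ∧ ∫ v, ψ v ∂m = ρ * ∫ v, ψ v * localMaxwellian 1 θ u v))
    (hz : z ∈ Φ.good) (hσ : 0 < σ) {r L : ℝ} (hr : 0 < r) (hr2 : r < 1 / 2) (hL : 1 ≤ L) {t : ℝ} (ht : 0 ≤ t)
    -- the coefficient
    (a : Fin 3 → Fin 3 → ℝ × T3 → ℝ) (ha : ∀ k l, Continuous (a k l)) {A : ℝ} (hA : ∀ k l p, |a k l p| ≤ A)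
    {ω : ℝ} (hω0 : 0 ≤ ω)
    (hω : ∀ k l (s t₀ : ℝ) (x x₀ : T3), |s - t₀| < r → Torus.euclidDist x x₀ < r → |a k l (t₀, x₀) - a k l (s, x)| ≤ ω)
    -- the cutoff and the contact value
    {gc Yt : ℝ → ℝ} (hgc : Continuous gc) (hYt : Continuous Yt) {Gb CgY η₀ ηY : ℝ} (hη₀ : 0 < η₀)
    (hgb : ∀ b, |gc b| ≤ Gb) (hgY : ∀ b, 0 ≤ b → |gc b * contactValue b| ≤ CgY) (hg0 : ∀ b, η₀ ≤ b → gc b = 0)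
    (hYeq : ∀ b, 0 < b → b ≤ ηY → Yt b = contactValue b) (hle : η₀ ≤ ηY)
    -- the bulk box
    {ρ₁ θ₁ Θ U : ℝ} (hρ₁ : 0 < ρ₁) (hθ₁ : 0 < θ₁) (hΘ : 0 < Θ) (hU : 0 < U)
    -- the random inputs of this orbit
    {K εC εP εPl κ η' : ℝ} (hK : ke z ≤ K)
    (hCM : collisionSum σ N Φ t (fun _ => 1) (fun _ => 1)
      (fun q => if L ^ 2 < ‖q.2.1‖ ^ 2 + ‖q.2.2‖ ^ 2 then 1 + ‖q.2.1‖ ^ 2 + ‖q.2.2‖ ^ 2 else 0) r z ≤ εC)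
    (hPEC : ∀ k l : Fin 3, ∫ t₀ in Icc 0 (t + 1), ∫ x₀,
      |collisionSum σ N Φ (t + 1) (fun p => r⁻¹ * max (1 - |p.1 - t₀| / r) 0 * cone r p.2 x₀) gc 𝒯[L, k, l] r z -
        σ ^ 3 * ∫ s in Icc 0 (t + 1), r⁻¹ * max (1 - |s - t₀| / r) 0 * ∫ x, cone r x x₀ *
          (gc (σ ^ 3 * rhoC r (Φ.flow s z) x) * contactValue (σ ^ 3 * rhoC r (Φ.flow s z) x) *
            pairFunctional r 𝒯[L, k, l] (Φ.flow s z) x)| ≤ εP)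
    (hPECl : ∫ t₀ in Icc 0 (t + 1), ∫ x₀,
      |collisionSum σ N Φ (t + 1) (fun p => r⁻¹ * max (1 - |p.1 - t₀| / r) 0 * cone r p.2 x₀) (fun b => |gc b|) ℬ[L] r z -
        σ ^ 3 * ∫ s in Icc 0 (t + 1), r⁻¹ * max (1 - |s - t₀| / r) 0 * ∫ x, cone r x x₀ *
          (|gc (σ ^ 3 * rhoC r (Φ.flow s z) x)| * contactValue (σ ^ 3 * rhoC r (Φ.flow s z) x) *
            pairFunctional r ℬ[L] (Φ.flow s z) x)| ≤ εPl)
    (hκ : ∫ s in Icc 0 t, ((N : ℝ) + 1)⁻¹ * ∑ i, cubeTail L ((Φ.flow s z) i).2 ≤ κ)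
    (hJ : ∀ j k : Fin 3, ∫ s in Icc 0 t, ∫ x,
      |bulkCut ρ₁ θ₁ Θ U (rhoC r (Φ.flow s z) x, uC r (Φ.flow s z) x, thetaC r (Φ.flow s z) x) *
          (gc (σ ^ 3 * rhoC r (Φ.flow s z) x) * Yt (σ ^ 3 * rhoC r (Φ.flow s z) x) * (σ ^ 3 * rhoC r (Φ.flow s z) x))| *
        |MpsiC r (Φ.flow s z) x (psiJK L j k) - rhoC r (Φ.flow s z) x *
          ∫ v, psiJK L j k v * localMaxwellian 1 (thetaC r (Φ.flow s z) x) (uC r (Φ.flow s z) x) v| ≤ η')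
    (hE : ∫ s in Icc 0 t, ∫ x,
      |bulkCut ρ₁ θ₁ Θ U (rhoC r (Φ.flow s z) x, uC r (Φ.flow s z) x, thetaC r (Φ.flow s z) x) *
          (gc (σ ^ 3 * rhoC r (Φ.flow s z) x) * Yt (σ ^ 3 * rhoC r (Φ.flow s z) x) * (σ ^ 3 * rhoC r (Φ.flow s z) x))| *
        |MpsiC r (Φ.flow s z) x (psiE L) - rhoC r (Φ.flow s z) x *
          ∫ v, psiE L v * localMaxwellian 1 (thetaC r (Φ.flow s z) x) (uC r (Φ.flow s z) x) v| ≤ η') :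
    |(∑ k : Fin 3, ∑ l : Fin 3, collisionSum σ N Φ t (a k l) gc (fun q => |⟪q.2.1 - q.2.2, q.1⟫_ℝ| * (q.1 k * q.1 l)) r z) -
      2 * ∫ s in Icc 0 t, ∫ x, gc (σ ^ 3 * rhoC r (Φ.flow s z) x) * pexC σ r (Φ.flow s z) x *
        ∑ k : Fin 3, a k k (s, x)| ≤
      9 * (A * Gb) * εC +
      9 * (ω * (2 * (εPl + (t + 4 * r) * (16 * Real.pi * L ^ 2 * CgY * η₀))) +
        2 * A * (2 * (εPl + 4 * r * (16 * Real.pi * L ^ 2 * CgY * η₀)) +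
          2 * (εPl + 5 * r * (16 * Real.pi * L ^ 2 * CgY * η₀)))) +
      9 * (A * εP) +
      9 * (CgY * (8 * Real.pi / 5) * η₀ * K * (ω * (t + 1) + 6 * A * r)) +
      120 * Real.pi * A * CgY * η₀ * κ +
      8 * Real.pi / 15 * (45 * (CgY * η₀) * (2 * A) * t *
          (2 * θ₁ + ρ₁ * Θ + (4 * L ^ 2 / (9 * Θ) + 8 * L ^ 2 / (3 * U ^ 2)) * K) +
        48 * (CgY * η₀) * (2 * A) * κ + 18 * (2 * A) * η') := by
  have hL0 : 0 < L := by linarith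
  have hσ3 : 0 < σ ^ 3 := pow_pos hσ 3
  have hA0 : 0 ≤ A := (abs_nonneg _).trans (hA 0 0 (0, 0))
  have hGb : 0 ≤ Gb := (abs_nonneg _).trans (hgb 0)
  have hCgY : 0 ≤ CgY := (abs_nonneg _).trans (hgY 0 le_rfl)
  have hCR0 : 0 ≤ 16 * Real.pi * L ^ 2 * CgY * η₀ := by positivity
  -- the data of the dominating mark
  have hga : Continuous fun b => |gc b| := hgc.abs
  have hga_nn : ∀ b, 0 ≤ |gc b| := fun b => abs_nonneg _
  have hgaY : ∀ b, 0 ≤ b → |(|gc b|) * contactValue b| ≤ CgY := fun b hb => by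
    rw [abs_mul, abs_abs, ← abs_mul]; exact hgY b hb
  have hga0 : ∀ b, η₀ ≤ b → |gc b| = 0 := fun b hb => by rw [hg0 b hb, abs_zero]
  -- (e1) velocity truncation
  have e1 := truncation_le Φ hz hσ hL0 t a hA gc hgb (r := r)
  -- (e2) smoothed versus instantaneous coefficient
  have e2 := coefficient_le Φ hz hσ hr hr2 hL0 t a ha hA hω0 hω gc
  -- (e2') the three layer counts
  have hK0 := layer_count_le Φ hz hσ hr hr2 hL0 (t := t) (lo := 0) (hi := t + 2 * r) le_rfl (by linarith) (by linarith)
    hga hga_nn hη₀.le hgaY hga0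
  have hK1 := layer_count_le Φ hz hσ hr hr2 hL0 (t := t) (lo := 0) (hi := 2 * r) le_rfl (by linarith) (by linarith)
    hga hga_nn hη₀.le hgaY hga0
  have hK2 := layer_count_le Φ hz hσ hr hr2 hL0 (t := t) (lo := max 0 (t - r)) (hi := t + 2 * r) (le_max_left _ _)
    (max_le (by linarith) (by linarith)) (by linarith) hga hga_nn hη₀.le hgaY hga0
  have eσ : ∀ c : ℝ, σ ^ 3 * (c * (16 * Real.pi * L ^ 2 * CgY * (η₀ / σ ^ 3))) = c * (16 * Real.pi * L ^ 2 * CgY * η₀) := by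
    intro c; field_simp
  rw [eσ] at hK0 hK1 hK2
  have hK0' : collisionSum σ N Φ (t + 1) (fun p => if 0 ≤ p.1 ∧ p.1 + r ≤ t + 2 * r then 1 else 0)
      (fun b => |gc b|) ℬ[L] r z ≤ 2 * (εPl + (t + 4 * r) * (16 * Real.pi * L ^ 2 * CgY * η₀)) := by
    refine hK0.trans ?_
    have : (t + 2 * r - 0 + 2 * r) = t + 4 * r := by ring
    rw [this]; linarith
  have hK1' : collisionSum σ N Φ (t + 1) (fun p => if 0 ≤ p.1 ∧ p.1 + r ≤ 2 * r then 1 else 0)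
      (fun b => |gc b|) ℬ[L] r z ≤ 2 * (εPl + 4 * r * (16 * Real.pi * L ^ 2 * CgY * η₀)) := by
    refine hK1.trans ?_
    have : (2 * r - 0 + 2 * r) = 4 * r := by ring
    rw [this]; linarith
  have hK2' : collisionSum σ N Φ (t + 1) (fun p => if max 0 (t - r) ≤ p.1 ∧ p.1 + r ≤ t + 2 * r then 1 else 0)
      (fun b => |gc b|) ℬ[L] r z ≤ 2 * (εPl + 5 * r * (16 * Real.pi * L ^ 2 * CgY * η₀)) := by
    refine hK2.trans ?_
    have hlen : t + 2 * r - max 0 (t - r) + 2 * r ≤ 5 * r := by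
      have := le_max_right 0 (t - r); linarith
    nlinarith [hlen, hCR0]
  -- (e3) the pointwise-Enskog-collision test, per `(k, l)`
  have e3 : ∀ k l : Fin 3, |collisionSum σ N Φ (t + 1) (fun p => ∫ t₀ in Icc 0 t, ∫ x₀,
      a k l (t₀, x₀) * (r⁻¹ * max (1 - |p.1 - t₀| / r) 0 * cone r p.2 x₀)) gc 𝒯[L, k, l] r z -
      σ ^ 3 * ∫ s in Icc 0 (t + 1), ∫ x, (∫ t₀ in Icc 0 t, ∫ x₀,
        a k l (t₀, x₀) * (r⁻¹ * max (1 - |s - t₀| / r) 0 * cone r x x₀)) *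
        (gc (σ ^ 3 * rhoC r (Φ.flow s z) x) * contactValue (σ ^ 3 * rhoC r (Φ.flow s z) x) *
          pairFunctional r 𝒯[L, k, l] (Φ.flow s z) x)| ≤ A * εP := fun k l =>
    (pec_test Φ hz hσ hr hr2 (by linarith : t ≤ t + 1) (ha k l) (hA k l) gc 𝒯[L, k, l]
      (measurable_F1 Φ hz hgc r L k l) (abs_F1_le Φ hσ.le hr hL0 hgY k l)).trans
      (mul_le_mul_of_nonneg_left (hPEC k l) hA0)
  -- (e4) the layer estimate on the Enskog side, per `(k, l)`
  have e4 : ∀ k l : Fin 3, |σ ^ 3 * (∫ s in Icc 0 (t + 1), ∫ x, (∫ t₀ in Icc 0 t, ∫ x₀,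
      a k l (t₀, x₀) * (r⁻¹ * max (1 - |s - t₀| / r) 0 * cone r x x₀)) *
        (gc (σ ^ 3 * rhoC r (Φ.flow s z) x) * contactValue (σ ^ 3 * rhoC r (Φ.flow s z) x) *
          pairFunctional r 𝒯[L, k, l] (Φ.flow s z) x)) -
      σ ^ 3 * ∫ s in Icc 0 t, ∫ x, a k l (s, x) *
        (gc (σ ^ 3 * rhoC r (Φ.flow s z) x) * contactValue (σ ^ 3 * rhoC r (Φ.flow s z) x) *
          pairFunctional r 𝒯[L, k, l] (Φ.flow s z) x)| ≤
      CgY * (8 * Real.pi / 5) * η₀ * K * (ω * (t + 1) + 6 * A * r) := fun k l =>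
    enskogSide_layer Φ hz hσ hr hr2 hL0 ht (ha k l) (hA k l) hω0 (hω k l) hgc hη₀.le hgY hg0 hK k l
  -- (e5) the exact value rewrite and (e6) the deviatoric split
  have e5 := enskogSide_value Φ hz hσ.le hr hL0 t a ha hA hgc hgY
  have e6 := enskogSide_split Φ hz hσ hr hr2 hL0 t a ha hA hgc hYt hη₀ hgY hg0 hYeq hle
  -- the quadratic tail is below the cubic one
  have hsq : ∫ s in Icc 0 t, ((N + 1 : ℕ) : ℝ)⁻¹ * ∑ i, sqTail L ((Φ.flow s z) i).2 ≤ κ := by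
    have hN : ((N : ℝ) + 1) = ((N + 1 : ℕ) : ℝ) := by push_cast; ring
    have h1 : ∫ s in Icc 0 t, ((N + 1 : ℕ) : ℝ)⁻¹ * ∑ i, sqTail L ((Φ.flow s z) i).2 ≤
        ∫ s in Icc 0 t, ((N : ℝ) + 1)⁻¹ * ∑ i, cubeTail L ((Φ.flow s z) i).2 := by
      refine setIntegral_mono_on (integrableOn_mean_sqTail Φ L hz 0 t) (integrableOn_mean_cubeTail Φ L hz 0 t)
        measurableSet_Icc fun s _ => ?_
      rw [hN]; exact mean_sqTail_le_mean_cubeTail hL _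
    exact h1.trans hκ
  -- (e7) the landed stress-isotropy estimate for the traceless part of `a` with the in-band weight
  have hgt : Continuous fun b => gc b * Yt b * b := (hgc.mul hYt).mul continuous_id
  have hgtb : ∀ b, 0 ≤ b → |gc b * Yt b * b| ≤ CgY * η₀ := fun b hb => by
    have hw := weight_facts hη₀ hgY hg0 hYeq hle hb
    rw [← hw.1]; exact hw.2
  have hatrb : ∀ j k, ∀ s ∈ Icc (0 : ℝ) t, ∀ x, |a j k (s, x) - (∑ i : Fin 3, a i i (s, x)) / 3 * (if j = k then (1 : ℝ) else 0)| ≤ 2 * A := by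
    intro j k s _ x
    refine (abs_sub _ _).trans ?_
    have hs : |∑ i : Fin 3, a i i (s, x)| ≤ 3 * A :=
      (Finset.abs_sum_le_sum_abs _ _).trans ((Finset.sum_le_sum fun i _ => hA i i _).trans (by
        simp only [Finset.sum_const, Finset.card_univ, Fintype.card_fin, nsmul_eq_mul]; push_cast; exact le_rfl))
    have hδ : |(if j = k then (1 : ℝ) else 0)| ≤ 1 := by split_ifs <;> simp
    have h1 : |(∑ i : Fin 3, a i i (s, x)) / 3 * (if j = k then (1 : ℝ) else 0)| ≤ A := by
      rw [abs_mul, abs_div, abs_of_pos (by norm_num : (0 : ℝ) < 3)]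
      calc |∑ i : Fin 3, a i i (s, x)| / 3 * |(if j = k then (1 : ℝ) else 0)| ≤ 3 * A / 3 * 1 :=
            mul_le_mul (div_le_div_of_nonneg_right hs (by norm_num)) hδ (abs_nonneg _) (by positivity)
        _ = A := by ring
    linarith [hA j k (s, x)]
  have e7 := ChaosClosesEulerStressIsotropy.pathwise_bound hMM hσ.le Φ hz hr hr2 ht
    (fun j k p => a j k p - (∑ i : Fin 3, a i i p) / 3 * (if j = k then (1 : ℝ) else 0)) (traceless_part a)
    (A := 2 * A) (by positivity) hatrb (fun b => gc b * Yt b * b) hgt (Gb := CgY * η₀) (by positivity) hgtb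
    hρ₁ hθ₁ hΘ hU hL (fun p => bulkCut ρ₁ θ₁ Θ U p * (gc (σ ^ 3 * p.1) * Yt (σ ^ 3 * p.1) * (σ ^ 3 * p.1)))
    (fun p => rfl) hK hκ hJ hE
  beta_reduce at e7
  -- assembling
  have hsum3 : |(∑ k : Fin 3, ∑ l : Fin 3, collisionSum σ N Φ (t + 1) (fun p => ∫ t₀ in Icc 0 t, ∫ x₀,
      a k l (t₀, x₀) * (r⁻¹ * max (1 - |p.1 - t₀| / r) 0 * cone r p.2 x₀)) gc 𝒯[L, k, l] r z) -
      ∑ k : Fin 3, ∑ l : Fin 3, σ ^ 3 * ∫ s in Icc 0 (t + 1), ∫ x, (∫ t₀ in Icc 0 t, ∫ x₀,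
        a k l (t₀, x₀) * (r⁻¹ * max (1 - |s - t₀| / r) 0 * cone r x x₀)) *
        (gc (σ ^ 3 * rhoC r (Φ.flow s z) x) * contactValue (σ ^ 3 * rhoC r (Φ.flow s z) x) *
          pairFunctional r 𝒯[L, k, l] (Φ.flow s z) x)| ≤ 9 * (A * εP) := by
    rw [← Finset.sum_sub_distrib]
    calc _ ≤ ∑ k : Fin 3, ∑ l : Fin 3, |collisionSum σ N Φ (t + 1) (fun p => ∫ t₀ in Icc 0 t, ∫ x₀,
          a k l (t₀, x₀) * (r⁻¹ * max (1 - |p.1 - t₀| / r) 0 * cone r p.2 x₀)) gc 𝒯[L, k, l] r z -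
          σ ^ 3 * ∫ s in Icc 0 (t + 1), ∫ x, (∫ t₀ in Icc 0 t, ∫ x₀,
            a k l (t₀, x₀) * (r⁻¹ * max (1 - |s - t₀| / r) 0 * cone r x x₀)) *
            (gc (σ ^ 3 * rhoC r (Φ.flow s z) x) * contactValue (σ ^ 3 * rhoC r (Φ.flow s z) x) *
              pairFunctional r 𝒯[L, k, l] (Φ.flow s z) x)| :=
          (Finset.abs_sum_le_sum_abs _ _).trans (Finset.sum_le_sum fun k _ => by
            rw [← Finset.sum_sub_distrib]; exact Finset.abs_sum_le_sum_abs _ _)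
      _ ≤ ∑ _k : Fin 3, ∑ _l : Fin 3, A * εP := Finset.sum_le_sum fun k _ => Finset.sum_le_sum fun l _ => e3 k l
      _ = 9 * (A * εP) := by simp only [Finset.sum_const, Finset.card_univ, Fintype.card_fin, nsmul_eq_mul]; push_cast; ring
  have hsum4 : |(∑ k : Fin 3, ∑ l : Fin 3, σ ^ 3 * ∫ s in Icc 0 (t + 1), ∫ x, (∫ t₀ in Icc 0 t, ∫ x₀,
        a k l (t₀, x₀) * (r⁻¹ * max (1 - |s - t₀| / r) 0 * cone r x x₀)) *
        (gc (σ ^ 3 * rhoC r (Φ.flow s z) x) * contactValue (σ ^ 3 * rhoC r (Φ.flow s z) x) *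
          pairFunctional r 𝒯[L, k, l] (Φ.flow s z) x)) -
      ∑ k : Fin 3, ∑ l : Fin 3, σ ^ 3 * ∫ s in Icc 0 t, ∫ x, a k l (s, x) *
        (gc (σ ^ 3 * rhoC r (Φ.flow s z) x) * contactValue (σ ^ 3 * rhoC r (Φ.flow s z) x) *
          pairFunctional r 𝒯[L, k, l] (Φ.flow s z) x)| ≤ 9 * (CgY * (8 * Real.pi / 5) * η₀ * K * (ω * (t + 1) + 6 * A * r)) := by
    rw [← Finset.sum_sub_distrib]
    calc _ ≤ ∑ k : Fin 3, ∑ l : Fin 3, |σ ^ 3 * (∫ s in Icc 0 (t + 1), ∫ x, (∫ t₀ in Icc 0 t, ∫ x₀,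
          a k l (t₀, x₀) * (r⁻¹ * max (1 - |s - t₀| / r) 0 * cone r x x₀)) *
            (gc (σ ^ 3 * rhoC r (Φ.flow s z) x) * contactValue (σ ^ 3 * rhoC r (Φ.flow s z) x) *
              pairFunctional r 𝒯[L, k, l] (Φ.flow s z) x)) -
          σ ^ 3 * ∫ s in Icc 0 t, ∫ x, a k l (s, x) *
            (gc (σ ^ 3 * rhoC r (Φ.flow s z) x) * contactValue (σ ^ 3 * rhoC r (Φ.flow s z) x) *
              pairFunctional r 𝒯[L, k, l] (Φ.flow s z) x)| :=
          (Finset.abs_sum_le_sum_abs _ _).trans (Finset.sum_le_sum fun k _ => by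
            rw [← Finset.sum_sub_distrib]; exact Finset.abs_sum_le_sum_abs _ _)
      _ ≤ ∑ _k : Fin 3, ∑ _l : Fin 3, CgY * (8 * Real.pi / 5) * η₀ * K * (ω * (t + 1) + 6 * A * r) :=
          Finset.sum_le_sum fun k _ => Finset.sum_le_sum fun l _ => e4 k l
      _ = _ := by simp only [Finset.sum_const, Finset.card_univ, Fintype.card_fin, nsmul_eq_mul]; push_cast; ring
  -- the final chain
  have hcoef : 9 * (ω * collisionSum σ N Φ (t + 1) (fun p => if 0 ≤ p.1 ∧ p.1 + r ≤ t + 2 * r then 1 else 0)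
        (fun b => |gc b|) ℬ[L] r z +
      2 * A * (collisionSum σ N Φ (t + 1) (fun p => if 0 ≤ p.1 ∧ p.1 + r ≤ 2 * r then 1 else 0) (fun b => |gc b|) ℬ[L] r z +
        collisionSum σ N Φ (t + 1) (fun p => if max 0 (t - r) ≤ p.1 ∧ p.1 + r ≤ t + 2 * r then 1 else 0)
          (fun b => |gc b|) ℬ[L] r z)) ≤
      9 * (ω * (2 * (εPl + (t + 4 * r) * (16 * Real.pi * L ^ 2 * CgY * η₀))) +
        2 * A * (2 * (εPl + 4 * r * (16 * Real.pi * L ^ 2 * CgY * η₀)) +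
          2 * (εPl + 5 * r * (16 * Real.pi * L ^ 2 * CgY * η₀)))) := by
    have h1 := mul_le_mul_of_nonneg_left hK0' hω0
    have h2 := mul_le_mul_of_nonneg_left (add_le_add hK1' hK2') (by positivity : (0 : ℝ) ≤ 2 * A)
    linarith
  have hCM' := mul_le_mul_of_nonneg_left hCM (by positivity : (0 : ℝ) ≤ 9 * (A * Gb))
  have hsq' := mul_le_mul_of_nonneg_left hsq (by positivity : (0 : ℝ) ≤ 120 * Real.pi * A * CgY * η₀)
  have e7' := mul_le_mul_of_nonneg_left e7 (by positivity : (0 : ℝ) ≤ 8 * Real.pi / 15)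
  -- conclude by the triangle inequality (linear arithmetic in the eight players)
  have hWS := le_abs_self (∫ s in Icc 0 t, ∫ x,
      (gc (σ ^ 3 * rhoC r (Φ.flow s z) x) * Yt (σ ^ 3 * rhoC r (Φ.flow s z) x) * (σ ^ 3 * rhoC r (Φ.flow s z) x)) *
        ∑ k : Fin 3, ∑ l : Fin 3, (a k l (s, x) - (∑ j : Fin 3, a j j (s, x)) / 3 * (if k = l then 1 else 0)) *
          (MpsiC r (Φ.flow s z) x (fun v => v k * v l) -
            momC r (Φ.flow s z) x k * momC r (Φ.flow s z) x l / rhoC r (Φ.flow s z) x))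
  have hWS' := neg_abs_le (∫ s in Icc 0 t, ∫ x,
      (gc (σ ^ 3 * rhoC r (Φ.flow s z) x) * Yt (σ ^ 3 * rhoC r (Φ.flow s z) x) * (σ ^ 3 * rhoC r (Φ.flow s z) x)) *
        ∑ k : Fin 3, ∑ l : Fin 3, (a k l (s, x) - (∑ j : Fin 3, a j j (s, x)) / 3 * (if k = l then 1 else 0)) *
          (MpsiC r (Φ.flow s z) x (fun v => v k * v l) -
            momC r (Φ.flow s z) x k * momC r (Φ.flow s z) x l / rhoC r (Φ.flow s z) x))
  have hπWS := mul_le_mul_of_nonneg_left hWS (by positivity : (0 : ℝ) ≤ 8 * Real.pi / 15)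
  have hπWS' := mul_le_mul_of_nonneg_left hWS' (by positivity : (0 : ℝ) ≤ 8 * Real.pi / 15)
  rw [mul_neg] at hπWS'
  obtain ⟨e1a, e1b⟩ := abs_le.1 e1
  obtain ⟨e2a, e2b⟩ := abs_le.1 e2
  obtain ⟨e3a, e3b⟩ := abs_le.1 hsum3
  obtain ⟨e4a, e4b⟩ := abs_le.1 hsum4
  obtain ⟨e6a, e6b⟩ := abs_le.1 e6
  rw [abs_le]
  constructor <;> linarith

end Core

/-! ## Registered sub-goal -/

/-- **Registered sub-goal `stub_pressureValueM` (helper M of `stub_pressureValueOfEnskog`): the traceless part of a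
coefficient is traceless.** [folklore] -/
theorem stub_pressureValueM : ∀ (a : Fin 3 → Fin 3 → ℝ × T3 → ℝ) (p : ℝ × T3), ∑ j : Fin 3, (a j j p - (∑ i : Fin 3, a i i p) / 3 * (if j = j then (1 : ℝ) else 0)) = 0 :=
  fun a p => traceless_part a p

end Summit.AtomisticToContinuum.HydrodynamicLimit.Theorems.ChaosClosesEulerPressureValue

end
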